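import Summits.Ventures.Crystal3D.Theorems.StickyWulffConstantPolycrystalWulffBoundHyperplaneNull
import Summits.Ventures.Crystal3D.Theorems.StickyWulffConstantTextureLiminfTexShadowDefs

/-!
# Quantile functions of a compact set along a direction (data for the charged-wall rung
# `rung_inclinedLamellar_of_quantiles`, line `PolyDensity`, crux `stmt-Ventures-19482`)

Route `StickyWulffConstant` of the venture `Summits/Ventures/Crystal3D`, second prover lane (poly-p2,
gen 8).  For a compact `B ⊆ B̄(0,R)` of volume `M` and a unit vector `n`, the cumulative section volume
`Φ(t) = |B ∩ {⟪y,n⟫ < t}|` is continuous (affine hyperplanes are null, `volume_setOf_inner_eq_zero`),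
vanishes below `−R−1` and equals `M` above `R+1`; the intermediate value theorem gives a QUANTILE
FUNCTION `q : [0,1] → [−R−1, R+1]` with `|B ∩ {q σ₁ < ⟪y,n⟫ < q σ₂}| ≥ (σ₂ − σ₁)·M`
(`exists_quantile_of_isCompact`) — exactly the data `q_f` of `PolyDensity.rung_inclinedLamellar_of_quantiles`
(`…RungInclined`) for the bodies `W(A_f)` (`R = √5`, `M = 32`).
WHAT THIS IS NOT: the mismatch bound `δ` between the quantile functions of `W` and `R_m W` (a 1-D
computation); the crux is not claimed. -/

noncomputable section

open scoped BigOperators InnerProductSpace ENNReal Topology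
open MeasureTheory Filter Set

namespace Summit.Ventures.Crystal3D.Theorems

open Summit.Ventures.Crystal3D.Cruxes.TextureLiminf.TexShadow (E3)

/-- **Quantile function of a compact set along a unit direction.** -/
theorem exists_quantile_of_isCompact (n : E3) (hn : ‖n‖ = 1) (B : Set E3) (hB : IsCompact B)
    {R : ℝ} (hR : 0 ≤ R) (hBR : B ⊆ Metric.closedBall 0 R) {M : ℝ} (hM0 : 0 ≤ M)
    (hBM : volume B = ENNReal.ofReal M) :
    ∃ q : ℝ → ℝ, (∀ σ, |q σ| ≤ R + 1) ∧
      ∀ σ₁ σ₂, 0 ≤ σ₁ → σ₁ ≤ σ₂ → σ₂ ≤ 1 →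
        ENNReal.ofReal ((σ₂ - σ₁) * M) ≤
          volume (B ∩ {y : E3 | q σ₁ < ⟪y, n⟫_ℝ ∧ ⟪y, n⟫_ℝ < q σ₂}) := by
  have hn0 : n ≠ 0 := by
    intro h; rw [h, norm_zero] at hn; exact zero_ne_one hn
  have hBm : MeasurableSet B := hB.isClosed.measurableSet
  have hBfin : volume B ≠ ⊤ := hB.measure_lt_top.ne
  have hcont_inner : Continuous fun y : E3 => ⟪y, n⟫_ℝ := continuous_id.inner continuous_const
  have hlt_m : ∀ t, MeasurableSet {y : E3 | ⟪y, n⟫_ℝ < t} := fun t =>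
    (isOpen_lt hcont_inner continuous_const).measurableSet
  -- the cumulative section volume
  set Φ : ℝ → ℝ := fun t => (volume (B ∩ {y : E3 | ⟪y, n⟫_ℝ < t})).toReal with hΦ
  have hfin : ∀ t, volume (B ∩ {y : E3 | ⟪y, n⟫_ℝ < t}) ≠ ⊤ := fun t =>
    ne_top_of_le_ne_top hBfin (measure_mono inter_subset_left)
  have hmono : Monotone Φ := by
    intro s t hst
    exact ENNReal.toReal_mono (hfin t) (measure_mono fun y hy => ⟨hy.1, lt_of_lt_of_le hy.2 hst⟩)
  have hinnerB : ∀ y ∈ B, |⟪y, n⟫_ℝ| ≤ R := by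
    intro y hy
    calc |⟪y, n⟫_ℝ| ≤ ‖y‖ * ‖n‖ := abs_real_inner_le_norm y n
      _ ≤ R * 1 := by rw [hn]; exact mul_le_mul_of_nonneg_right (mem_closedBall_zero_iff.1 (hBR hy)) zero_le_one
      _ = R := mul_one R
  have hΦlow : Φ (-(R + 1)) = 0 := by
    have : B ∩ {y : E3 | ⟪y, n⟫_ℝ < -(R + 1)} = ∅ := by
      ext y
      simp only [mem_inter_iff, mem_setOf_eq, mem_empty_iff_false, iff_false, not_and, not_lt]
      intro hy
      have := (abs_le.1 (hinnerB y hy)).1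
      linarith
    rw [hΦ]; simp only []
    rw [this, measure_empty, ENNReal.toReal_zero]
  have hΦhigh : Φ (R + 1) = M := by
    have : B ∩ {y : E3 | ⟪y, n⟫_ℝ < R + 1} = B := by
      ext y
      simp only [mem_inter_iff, mem_setOf_eq, and_iff_left_iff_imp]
      intro hy
      have := (abs_le.1 (hinnerB y hy)).2
      linarith
    rw [hΦ]; simp only []
    rw [this, hBM, ENNReal.toReal_ofReal hM0]
  -- continuity of `Φ` (hyperplanes are null)
  have hplane : ∀ t, volume (B ∩ {y : E3 | ⟪y, n⟫_ℝ = t}) = 0 := by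
    intro t
    refine measure_mono_null inter_subset_right ?_
    have h := volume_setOf_inner_eq_zero hn0 t
    have hset : {y : E3 | ⟪y, n⟫_ℝ = t} = {y : E3 | ⟪n, y⟫_ℝ = t} := by
      ext y; rw [mem_setOf_eq, mem_setOf_eq, real_inner_comm]
    rw [hset]; exact h
  have hcontΦ : Continuous Φ := by
    rw [Metric.continuous_iff]
    intro t ε hε
    -- from below: `B ∩ {< t} = ⋃_k B ∩ {< t - 1/(k+1)}`
    set Sk : ℕ → Set E3 := fun k => B ∩ {y : E3 | ⟪y, n⟫_ℝ < t - 1 / ((k : ℝ) + 1)} with hSk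
    have hSk_mono : Monotone Sk := by
      intro i j hij y hy
      refine ⟨hy.1, ?_⟩
      show ⟪y, n⟫_ℝ < t - 1 / ((j : ℝ) + 1)
      have hy2 : ⟪y, n⟫_ℝ < t - 1 / ((i : ℝ) + 1) := hy.2
      refine lt_of_lt_of_le hy2 ?_
      have : (1 : ℝ) / ((j : ℝ) + 1) ≤ 1 / ((i : ℝ) + 1) :=
        one_div_le_one_div_of_le (by positivity) (by exact_mod_cast Nat.succ_le_succ hij)
      linarith
    have hSk_union : (⋃ k, Sk k) = B ∩ {y : E3 | ⟪y, n⟫_ℝ < t} := by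
      ext y
      simp only [mem_iUnion, hSk, mem_inter_iff, mem_setOf_eq]
      constructor
      · rintro ⟨k, hyB, hyk⟩
        exact ⟨hyB, lt_of_lt_of_le hyk (by
          have : (0 : ℝ) < 1 / ((k : ℝ) + 1) := by positivity
          linarith)⟩
      · rintro ⟨hyB, hyt⟩
        obtain ⟨k, hk⟩ := exists_nat_one_div_lt (sub_pos.2 hyt)
        exact ⟨k, hyB, by linarith⟩
    have hlow_lim : Tendsto (fun k => (volume (Sk k)).toReal) atTop (𝓝 (Φ t)) := by
      have h := tendsto_measure_iUnion_atTop (μ := volume) hSk_mono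
      rw [hSk_union] at h
      exact (ENNReal.tendsto_toReal (hfin t)).comp h
    -- from above: `B ∩ {≤ t} = ⋂_k B ∩ {< t + 1/(k+1)}`, and the plane `{= t}` is null
    set Tk : ℕ → Set E3 := fun k => B ∩ {y : E3 | ⟪y, n⟫_ℝ < t + 1 / ((k : ℝ) + 1)} with hTk
    have hTk_anti : Antitone Tk := by
      intro i j hij y hy
      refine ⟨hy.1, ?_⟩
      show ⟪y, n⟫_ℝ < t + 1 / ((i : ℝ) + 1)
      have hy2 : ⟪y, n⟫_ℝ < t + 1 / ((j : ℝ) + 1) := hy.2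
      refine lt_of_lt_of_le hy2 ?_
      have : (1 : ℝ) / ((j : ℝ) + 1) ≤ 1 / ((i : ℝ) + 1) :=
        one_div_le_one_div_of_le (by positivity) (by exact_mod_cast Nat.succ_le_succ hij)
      linarith
    have hTk_inter : (⋂ k, Tk k) = B ∩ {y : E3 | ⟪y, n⟫_ℝ ≤ t} := by
      ext y
      simp only [mem_iInter, hTk, mem_inter_iff, mem_setOf_eq]
      constructor
      · intro h
        refine ⟨(h 0).1, le_of_forall_pos_lt_add fun δ hδ => ?_⟩
        obtain ⟨k, hk⟩ := exists_nat_one_div_lt hδ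
        have := (h k).2
        linarith
      · rintro ⟨hyB, hyt⟩ k
        exact ⟨hyB, lt_of_le_of_lt hyt (by
          have : (0 : ℝ) < 1 / ((k : ℝ) + 1) := by positivity
          linarith)⟩
    have hle_eq : volume (B ∩ {y : E3 | ⟪y, n⟫_ℝ ≤ t}) = volume (B ∩ {y : E3 | ⟪y, n⟫_ℝ < t}) := by
      have hsplit : B ∩ {y : E3 | ⟪y, n⟫_ℝ ≤ t} =
          (B ∩ {y : E3 | ⟪y, n⟫_ℝ < t}) ∪ (B ∩ {y : E3 | ⟪y, n⟫_ℝ = t}) := by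
        ext y
        simp only [mem_inter_iff, mem_setOf_eq, mem_union]
        constructor
        · rintro ⟨hyB, hyt⟩
          rcases hyt.lt_or_eq with h | h
          · exact Or.inl ⟨hyB, h⟩
          · exact Or.inr ⟨hyB, h⟩
        · rintro (⟨hyB, h⟩ | ⟨hyB, h⟩)
          · exact ⟨hyB, h.le⟩
          · exact ⟨hyB, h.le⟩
      rw [hsplit]
      apply le_antisymm
      · calc volume (B ∩ {y : E3 | ⟪y, n⟫_ℝ < t} ∪ B ∩ {y : E3 | ⟪y, n⟫_ℝ = t})
            ≤ volume (B ∩ {y : E3 | ⟪y, n⟫_ℝ < t}) + volume (B ∩ {y : E3 | ⟪y, n⟫_ℝ = t}) :=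
              measure_union_le _ _
          _ = volume (B ∩ {y : E3 | ⟪y, n⟫_ℝ < t}) := by rw [hplane t, add_zero]
      · exact measure_mono subset_union_left
    have hhigh_lim : Tendsto (fun k => (volume (Tk k)).toReal) atTop (𝓝 (Φ t)) := by
      have h := tendsto_measure_iInter_atTop (μ := volume)
        (fun k => ((hBm.inter (hlt_m _)).nullMeasurableSet)) hTk_anti ⟨0, hfin _⟩
      rw [hTk_inter, hle_eq] at h
      exact (ENNReal.tendsto_toReal (hfin t)).comp h
    -- extract an index
    obtain ⟨k₁, hk₁⟩ := (Metric.tendsto_atTop.1 hlow_lim) (ε / 2) (half_pos hε)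
    obtain ⟨k₂, hk₂⟩ := (Metric.tendsto_atTop.1 hhigh_lim) (ε / 2) (half_pos hε)
    set kk : ℕ := max k₁ k₂ with hkk
    refine ⟨1 / ((kk : ℝ) + 1), by positivity, fun s hs => ?_⟩
    have h1 := hk₁ kk (le_max_left _ _)
    have h2 := hk₂ kk (le_max_right _ _)
    rw [Real.dist_eq] at h1 h2 hs ⊢
    have hs' := abs_lt.1 hs
    -- `Φ(t − 1/(kk+1)) ≤ Φ s ≤ Φ(t + 1/(kk+1))`
    have hlo : (volume (Sk kk)).toReal ≤ Φ s := hmono (by linarith [hs'.1])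
    have hhi : Φ s ≤ (volume (Tk kk)).toReal := hmono (by linarith [hs'.2])
    have h1' := abs_lt.1 h1
    have h2' := abs_lt.1 h2
    rw [abs_lt]
    constructor <;> linarith
  -- the quantile function by the intermediate value theorem
  have hIVT : ∀ σ : ℝ, 0 ≤ σ → σ ≤ 1 → ∃ t ∈ Icc (-(R + 1)) (R + 1), Φ t = σ * M := by
    intro σ h0 h1
    have hmem : σ * M ∈ Icc (Φ (-(R + 1))) (Φ (R + 1)) := by
      rw [hΦlow, hΦhigh]
      exact ⟨by positivity, by nlinarith⟩
    exact intermediate_value_Icc (by linarith) hcontΦ.continuousOn hmem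
  classical
  set q : ℝ → ℝ := fun σ =>
    if h : 0 ≤ σ ∧ σ ≤ 1 then (hIVT σ h.1 h.2).choose else 0 with hq
  have hq_spec : ∀ σ, 0 ≤ σ → σ ≤ 1 → q σ ∈ Icc (-(R + 1)) (R + 1) ∧ Φ (q σ) = σ * M := by
    intro σ h0 h1
    have hh : 0 ≤ σ ∧ σ ≤ 1 := ⟨h0, h1⟩
    rw [hq]; simp only [dif_pos hh]
    exact (hIVT σ h0 h1).choose_spec
  refine ⟨q, fun σ => ?_, fun σ₁ σ₂ h0 h12 h1 => ?_⟩
  · by_cases hh : 0 ≤ σ ∧ σ ≤ 1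
    · have := (hq_spec σ hh.1 hh.2).1
      exact abs_le.2 ⟨this.1, this.2⟩
    · rw [hq]; simp only [dif_neg hh, abs_zero]; positivity
  · obtain ⟨-, hΦ1⟩ := hq_spec σ₁ h0 (h12.trans h1)
    obtain ⟨-, hΦ2⟩ := hq_spec σ₂ (h0.trans h12) h1
    -- `|B ∩ {q₁ < · < q₂}| ≥ Φ(q₂) − Φ(q₁) − |plane at q₁|`
    have hsub : B ∩ {y : E3 | ⟪y, n⟫_ℝ < q σ₂} ⊆
        (B ∩ {y : E3 | q σ₁ < ⟪y, n⟫_ℝ ∧ ⟪y, n⟫_ℝ < q σ₂}) ∪ (B ∩ {y : E3 | ⟪y, n⟫_ℝ ≤ q σ₁}) := by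
      rintro y ⟨hyB, hy2⟩
      by_cases hy1 : q σ₁ < ⟪y, n⟫_ℝ
      · exact Or.inl ⟨hyB, hy1, hy2⟩
      · exact Or.inr ⟨hyB, not_lt.1 hy1⟩
    -- `|B ∩ {≤ q₁}| = Φ(q₁)` by the null plane (as in the continuity step)
    have hle_eq1 : volume (B ∩ {y : E3 | ⟪y, n⟫_ℝ ≤ q σ₁}) ≤
        volume (B ∩ {y : E3 | ⟪y, n⟫_ℝ < q σ₁}) + volume (B ∩ {y : E3 | ⟪y, n⟫_ℝ = q σ₁}) := by
      refine (measure_mono ?_).trans (measure_union_le _ _)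
      rintro y ⟨hyB, hyt⟩
      have hyt' : ⟪y, n⟫_ℝ ≤ q σ₁ := hyt
      rcases hyt'.lt_or_eq with h | h
      · exact Or.inl ⟨hyB, h⟩
      · exact Or.inr ⟨hyB, h⟩
    rw [hplane, add_zero] at hle_eq1
    have hmain : volume (B ∩ {y : E3 | ⟪y, n⟫_ℝ < q σ₂}) ≤
        volume (B ∩ {y : E3 | q σ₁ < ⟪y, n⟫_ℝ ∧ ⟪y, n⟫_ℝ < q σ₂}) +
          volume (B ∩ {y : E3 | ⟪y, n⟫_ℝ < q σ₁}) :=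
      (measure_mono hsub).trans ((measure_union_le _ _).trans (by gcongr))
    -- to reals
    have hfinW : volume (B ∩ {y : E3 | q σ₁ < ⟪y, n⟫_ℝ ∧ ⟪y, n⟫_ℝ < q σ₂}) ≠ ⊤ :=
      ne_top_of_le_ne_top hBfin (measure_mono inter_subset_left)
    have hreal := ENNReal.toReal_mono (ENNReal.add_ne_top.2 ⟨hfinW, hfin _⟩) hmain
    rw [ENNReal.toReal_add hfinW (hfin _)] at hreal
    have e2 : (volume (B ∩ {y : E3 | ⟪y, n⟫_ℝ < q σ₂})).toReal = σ₂ * M := hΦ2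
    have e1 : (volume (B ∩ {y : E3 | ⟪y, n⟫_ℝ < q σ₁})).toReal = σ₁ * M := hΦ1
    rw [e2, e1] at hreal
    rw [← ENNReal.ofReal_toReal hfinW]
    exact ENNReal.ofReal_le_ofReal (by linarith)

end Summit.Ventures.Crystal3D.Theorems

end
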